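import Mathlib
import Summits.MatrixMultiplication.Statement
import Summits.MatrixMultiplication.MatrixMultiplication.Theorems.GraphEquationsCubicShapes

/-!
# GraphEquations — the cubic normal form `NFₙ` (M42c; cell `decomp-mm`, lens-5 g40)

Helper kernel beneath the attacked crux `MultiplicityReduction` (stmt-MatrixMultiplication-27806) of
route `GraphEquations`, rung `K = 3` of the degree ladder (cubic tests, `GraphEquationsCubicRung`).

**NFₙ (function level).**  For `n ≥ 3`, every `t ∈ ℂ[A,B,C]` of total degree `≤ 3` that vanishes on the
graph `W_n = {C = AB}` is, as a function on `ℂ^{3n²}`, an AFFINE TEST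
(`GraphEquationsAffineQuadric.AffTest`):

  `t(A,B,C) = ⟨κ + L_A A + L_B B + M C, C − AB⟩`            (`exists_affTest_of_cubic`).

Proof (sorry-free).  By `GraphEquationsTorusWeights.eval_component_eq_zero` every torus-weight component of
`t` vanishes on `W_n`; by `GraphEquationsCubicShapes` each has a rigid shape (`hasForm_component_*`,
`t = lowPart t + Σ_{m named} t_m`, `lowPart_add_named`): weight `(3,3)` is a pure
`C`-cubic — killed by `eq_zero_of_vanishing_on_products` (M39); `(3,2)` / `(2,3)` are `Σ α_{qq'}(A) c_q c_{q'}`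
/ in `B` — their symmetric parts die by the quadratic one-sided syzygy theorems (M39), hence so do the
quadratic forms; `(3,1)` / `(1,3)` die by the one-sided syzygy theorems (M38); for `(2,2) = ⟨S C, C⟩ +
Σ β_q(A,B) c_q` the Koszul shift `β + S·φ` is a bilinear syzygy, so by the `(1,1)`-syzygy theorem (M36 — the
only place `n ≥ 3` is used) `β_q = ((Λ − S)·AB)_q` with `Λ` antisymmetric (`eval_component_22`); the low
part is `R(A,B) + ⟨κ + L_A A + L_B B, C⟩` and vanishing at `C = AB` forces `R = −⟨κ + L_A A + L_B B, AB⟩`.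
Then `t = ⟨κ + L_A A + L_B B + (Λ + S) C, C − AB⟩`.  Consumer: `GraphEquationsCubicDictionary`
(`AffSystem.AffineQuadricRigidity n → CubicReduction n`, `n ≥ 3`).
-/

set_option linter.dupNamespace false
set_option linter.unusedSectionVars false

noncomputable section

namespace Summit.MatrixMultiplication.MatrixMultiplication.Theorems.GraphEquations

open MvPolynomial Matrix

variable {n : ℕ}

/-! ## Shapes of the weighted homogeneous components of a cubic -/

section Components

variable {t : MvPolynomial (GraphVars n) ℂ} (ht : t.totalDegree ≤ 3)
include ht

/-- Monomials of `t` have degree `≤ 3`. -/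
theorem degree_le_three {d : GraphVars n →₀ ℕ} (hd : d ∈ t.support) : (d.sum fun _ e => e) ≤ 3 :=
  (le_totalDegree hd).trans ht

/-- Generic component lemma. -/
theorem hasForm_component {D : Type*} [AddCommMonoid D] (F : D →+ Fn3 n) (m : ℕ × ℕ)
    (hmono : ∀ (d : GraphVars n →₀ ℕ) (c : ℂ), (d.sum fun _ e => e) ≤ 3 → Finsupp.weight wt d = m →
      HasForm F (monomial d c)) :
    HasForm F (weightedHomogeneousComponent wt m t) := by
  classical
  rw [weightedHomogeneousComponent_apply]
  apply hasForm_sum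
  intro d hd
  rw [Finset.mem_filter] at hd
  exact hmono d _ (degree_le_three ht hd.1) hd.2

/-- Shape of the `(3,3)` component. -/
theorem hasForm_component_33 : HasForm readC (weightedHomogeneousComponent wt (3, 3) t) :=
  hasForm_component ht readC _ fun _ c hd hw => hasForm_monomial_33 hd c hw
/-- Shape of the `(3,2)` component. -/
theorem hasForm_component_32 : HasForm readAQ (weightedHomogeneousComponent wt (3, 2) t) :=
  hasForm_component ht readAQ _ fun _ c hd hw => hasForm_monomial_32 hd c hw
/-- Shape of the `(2,3)` component. -/
theorem hasForm_component_23 : HasForm readBQ (weightedHomogeneousComponent wt (2, 3) t) :=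
  hasForm_component ht readBQ _ fun _ c hd hw => hasForm_monomial_23 hd c hw
/-- Shape of the `(3,1)` component. -/
theorem hasForm_component_31 : HasForm readAL (weightedHomogeneousComponent wt (3, 1) t) :=
  hasForm_component ht readAL _ fun _ c hd hw => hasForm_monomial_31 hd c hw
/-- Shape of the `(1,3)` component. -/
theorem hasForm_component_13 : HasForm readBL (weightedHomogeneousComponent wt (1, 3) t) :=
  hasForm_component ht readBL _ fun _ c hd hw => hasForm_monomial_13 hd c hw
/-- Shape of the `(2,2)` component. -/
theorem hasForm_component_22 : HasForm readCC (weightedHomogeneousComponent wt (2, 2) t) :=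
  hasForm_component ht readCC _ fun _ c hd hw => hasForm_monomial_22 hd c hw

/-- Shape of an un-named component. -/
theorem hasForm_component_low {m : ℕ × ℕ} (hm : m ∉ named) :
    HasForm readLow (weightedHomogeneousComponent wt m t) :=
  hasForm_component ht readLow m fun _ c hd hw => hasForm_monomial_low hd c (hw ▸ hm)

/-- The LOW PART of `t`: the sum of its components of un-named weight. -/
def lowPart (t : MvPolynomial (GraphVars n) ℂ) : MvPolynomial (GraphVars n) ℂ :=
  ∑ m ∈ (Finset.image (Finsupp.weight wt) t.support ∪ named) \ named, weightedHomogeneousComponent wt m t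

omit ht in
/-- `t = lowPart t + Σ_{m named} t_m`. -/
theorem lowPart_add_named (t : MvPolynomial (GraphVars n) ℂ) :
    lowPart t + (weightedHomogeneousComponent wt (3, 3) t + weightedHomogeneousComponent wt (3, 2) t
      + weightedHomogeneousComponent wt (2, 3) t + weightedHomogeneousComponent wt (3, 1) t
      + weightedHomogeneousComponent wt (1, 3) t + weightedHomogeneousComponent wt (2, 2) t) = t := by
  classical
  have h := sum_weightedHomogeneousComponent_eq t (Finset.image (Finsupp.weight wt) t.support ∪ named)
    Finset.subset_union_left
  rw [← Finset.sum_sdiff (Finset.subset_union_right (s₁ := Finset.image (Finsupp.weight wt) t.support)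
    (s₂ := named)), sum_named] at h
  exact h

/-- Shape of the low part. -/
theorem hasForm_lowPart : HasForm readLow (lowPart t) := by
  classical
  unfold lowPart
  apply hasForm_sum
  intro m hm
  rw [Finset.mem_sdiff] at hm
  exact hasForm_component_low ht hm.2

end Components

/-! ## Killing the named components on the graph -/

/-- A two-sided family with vanishing symmetric part has vanishing quadratic form. -/
theorem bilFormEval_self_eq_zero {α : TwoSided n} (h : ∀ q q', α q q' + α q' q = 0) (P x : Vec n) :
    bilFormEval α P x x = 0 := by
  have h2 : bilFormEval α P x x + bilFormEval α P x x = 0 := by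
    nth_rewrite 2 [bilFormEval]
    rw [Finset.sum_comm, bilFormEval, ← Finset.sum_add_distrib]
    apply Finset.sum_eq_zero
    intro q _
    rw [← Finset.sum_add_distrib]
    apply Finset.sum_eq_zero
    intro q' _
    have := congrArg (eval P) (h q q')
    rw [map_add, map_zero] at this
    calc eval P (α q q') * x q * x q' + eval P (α q' q) * x q' * x q
        = (eval P (α q q') + eval P (α q' q)) * (x q * x q') := by ring
      _ = 0 := by rw [this, zero_mul]
  have : (2 : ℂ) * bilFormEval α P x x = 0 := by rw [two_mul]; exact h2
  simpa using this

/-- `(Sᵀ x)·y = (S y)·x`. -/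
theorem transpose_mulVec_dotProduct (S : SqMat n) (x y : Vec n) : (Sᵀ *ᵥ x) ⬝ᵥ y = (S *ᵥ y) ⬝ᵥ x := by
  rw [mulVec_transpose, ← dotProduct_mulVec, dotProduct_comm]

/-- For symmetric `S`: `(S x)·y = (S y)·x`. -/
theorem mulVec_dotProduct_comm_of_symm {S : SqMat n} (hS : Sᵀ = S) (x y : Vec n) :
    (S *ᵥ x) ⬝ᵥ y = (S *ᵥ y) ⬝ᵥ x := by
  rw [← transpose_mulVec_dotProduct, hS]

/-- For antisymmetric `Λ`: `(Λ x)·y = −(Λ y)·x`. -/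
theorem mulVec_dotProduct_anticomm {Λ : SqMat n} (hΛ : Λᵀ = -Λ) (x y : Vec n) :
    (Λ *ᵥ x) ⬝ᵥ y = -((Λ *ᵥ y) ⬝ᵥ x) := by
  rw [← transpose_mulVec_dotProduct, hΛ, neg_mulVec, neg_dotProduct]

/-- For antisymmetric `Λ`: `(Λ x)·x = 0`. -/
theorem mulVec_dotProduct_self_eq_zero {Λ : SqMat n} (hΛ : Λᵀ = -Λ) (x : Vec n) : (Λ *ᵥ x) ⬝ᵥ x = 0 := by
  have h := mulVec_dotProduct_anticomm hΛ x x
  have : (2 : ℂ) * ((Λ *ᵥ x) ⬝ᵥ x) = 0 := by rw [two_mul]; nth_rewrite 1 [h]; ring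
  simpa using this

/-- The symmetrisation does not change the quadratic form. -/
theorem symmPart_quad (S : SqMat n) (x : Vec n) :
    (((1 / 2 : ℂ) • (S + Sᵀ)) *ᵥ x) ⬝ᵥ x = (S *ᵥ x) ⬝ᵥ x := by
  rw [smul_mulVec, smul_dotProduct, add_mulVec, add_dotProduct, transpose_mulVec_dotProduct,
    smul_eq_mul]
  ring

/-- The symmetrisation is symmetric. -/
theorem symmPart_transpose (S : SqMat n) : ((1 / 2 : ℂ) • (S + Sᵀ))ᵀ = (1 / 2 : ℂ) • (S + Sᵀ) := by
  rw [transpose_smul, transpose_add, transpose_transpose, add_comm]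

section Kill

variable {t : MvPolynomial (GraphVars n) ℂ} (ht : t.totalDegree ≤ 3) (hv : ∀ x ∈ mmGraph n, eval x t = 0)
include ht hv

/-- Weight `(3,3)` dies. -/
theorem eval_component_33 (A B C : Vec n) : eval (pt A B C) (weightedHomogeneousComponent wt (3, 3) t) = 0 := by
  obtain ⟨K, hK⟩ := hasForm_component_33 ht
  have hK0 : K = 0 := by
    apply eq_zero_of_vanishing_on_products
    intro A' B'
    have h := eval_component_eq_zero hv (3, 3) (pt_prodVec_mem A' B')
    rw [hK] at h
    exact h
  rw [hK]; show eval C K = 0; rw [hK0, map_zero]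

/-- Weight `(3,2)` dies. -/
theorem eval_component_32 (A B C : Vec n) : eval (pt A B C) (weightedHomogeneousComponent wt (3, 2) t) = 0 := by
  obtain ⟨α, hα⟩ := hasForm_component_32 ht
  have hs : ∀ q q', α q q' + α q' q = 0 := by
    apply symm_eq_zero_of_left_quad_syzygy
    intro A' B'
    have h := eval_component_eq_zero hv (3, 2) (pt_prodVec_mem A' B')
    rw [hα] at h
    exact h
  rw [hα]; exact bilFormEval_self_eq_zero hs A C

/-- Weight `(2,3)` dies. -/
theorem eval_component_23 (A B C : Vec n) : eval (pt A B C) (weightedHomogeneousComponent wt (2, 3) t) = 0 := by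
  obtain ⟨α, hα⟩ := hasForm_component_23 ht
  have hs : ∀ q q', α q q' + α q' q = 0 := by
    apply symm_eq_zero_of_right_quad_syzygy
    intro A' B'
    have h := eval_component_eq_zero hv (2, 3) (pt_prodVec_mem A' B')
    rw [hα] at h
    exact h
  rw [hα]; exact bilFormEval_self_eq_zero hs B C

/-- Weight `(3,1)` dies. -/
theorem eval_component_31 (A B C : Vec n) : eval (pt A B C) (weightedHomogeneousComponent wt (3, 1) t) = 0 := by
  obtain ⟨α, hα⟩ := hasForm_component_31 ht
  have h0 : α = 0 := by
    apply eq_zero_of_left_syzygy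
    intro A' B'
    have h := eval_component_eq_zero hv (3, 1) (pt_prodVec_mem A' B')
    rw [hα] at h
    exact h
  rw [hα, h0, map_zero]; rfl

/-- Weight `(1,3)` dies. -/
theorem eval_component_13 (A B C : Vec n) : eval (pt A B C) (weightedHomogeneousComponent wt (1, 3) t) = 0 := by
  obtain ⟨α, hα⟩ := hasForm_component_13 ht
  have h0 : α = 0 := by
    apply eq_zero_of_right_syzygy
    intro A' B'
    have h := eval_component_eq_zero hv (1, 3) (pt_prodVec_mem A' B')
    rw [hα] at h
    exact h
  rw [hα, h0, map_zero]; rfl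

omit ht hv in
/-- The Koszul correction of a bilinear tensor by a matrix `S`: `Bc' = Bc + (q,(p,k),(k,r)) ↦ S q (p,r)`. -/
theorem bilEval_koszulShift (Bc : BilCoeff n) (S : SqMat n) (q : Fin n × Fin n) (A B : Vec n) :
    bilEval (fun q v w => Bc q v w + if v.2 = w.1 then S q (v.1, w.2) else 0) q A B
      = bilEval Bc q A B + (S *ᵥ prodVec A B) q := by
  classical
  have h := bilEval_add Bc (fun q v w => if v.2 = w.1 then S q (v.1, w.2) else 0) q A B
  rw [show (Bc + fun q v w => if v.2 = w.1 then S q (v.1, w.2) else 0)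
      = (fun q v w => Bc q v w + if v.2 = w.1 then S q (v.1, w.2) else 0) from rfl] at h
  rw [h, bilEval_of_koszul (Λ := fun q q' => S q q') (fun q v w => rfl)]
  rfl

/-- **Weight `(2,2)` (the only use of `n ≥ 3`).**  The component is `⟨S C, C⟩ + ⟨(Λ − S)·AB, C⟩` with `S`
symmetric and `Λ` antisymmetric. -/
theorem eval_component_22 (hn : 3 ≤ n) : ∃ S Λ : SqMat n, Sᵀ = S ∧ Λᵀ = -Λ ∧ ∀ A B C : Vec n,
    eval (pt A B C) (weightedHomogeneousComponent wt (2, 2) t)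
      = (S *ᵥ C) ⬝ᵥ C + ((Λ - S) *ᵥ prodVec A B) ⬝ᵥ C := by
  classical
  obtain ⟨⟨S₀, Bc⟩, hd⟩ := hasForm_component_22 ht
  obtain ⟨S, hS, hSq⟩ : ∃ S : SqMat n, Sᵀ = S ∧ ∀ x : Vec n, (S *ᵥ x) ⬝ᵥ x = (S₀ *ᵥ x) ⬝ᵥ x :=
    ⟨_, symmPart_transpose S₀, symmPart_quad S₀⟩
  have hd' : ∀ A B C : Vec n, eval (pt A B C) (weightedHomogeneousComponent wt (2, 2) t)
      = (S *ᵥ C) ⬝ᵥ C + ∑ q, bilEval Bc q A B * C q := by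
    intro A B C; rw [hd, hSq]; rfl
  -- the shifted tensor is a bilinear syzygy
  have hsyz : IsBilinearSyzygy (fun q v w => Bc q v w + if v.2 = w.1 then S q (v.1, w.2) else 0) := by
    intro A B
    have h := eval_component_eq_zero hv (2, 2) (pt_prodVec_mem A B)
    rw [hd', dotProduct] at h
    show ∑ q, bilEval (fun q v w => Bc q v w + if v.2 = w.1 then S q (v.1, w.2) else 0) q A B
      * prodVec A B q = 0
    simp only [bilEval_koszulShift, add_mul, Finset.sum_add_distrib]
    rw [add_comm]; exact h
  obtain ⟨Λf, hanti, hBc'⟩ := isKoszul_of_bilinear_syzygy hn hsyz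
  refine ⟨S, Matrix.of fun q q' => Λf q q', hS, ?_, fun A B C => ?_⟩
  · ext q q'; simp only [transpose_apply, Matrix.of_apply, Matrix.neg_apply]; exact hanti q' q
  · rw [hd']
    congr 1
    rw [dotProduct]
    refine Finset.sum_congr rfl fun q _ => ?_
    have h1 := bilEval_of_koszul hBc' q A B
    rw [bilEval_koszulShift Bc S q A B] at h1
    have h2 : bilEval Bc q A B
        = ((Matrix.of fun q q' => Λf q q') *ᵥ prodVec A B) q - (S *ᵥ prodVec A B) q := by
      rw [eq_sub_iff_add_eq, h1]
      simp only [mulVec, dotProduct, Matrix.of_apply, prodVec]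
    rw [h2, sub_mulVec, Pi.sub_apply]

end Kill

/-! ## The normal form -/

/-- **NFₙ (cubic normal form, function level).**  For `n ≥ 3`, a polynomial of total degree `≤ 3`
vanishing on the graph `W_n` is, as a function, an affine test `⟨κ + L_A A + L_B B + M C, C − AB⟩`. -/
theorem exists_affTest_of_cubic (hn : 3 ≤ n) {t : MvPolynomial (GraphVars n) ℂ} (ht : t.totalDegree ≤ 3)
    (hv : ∀ x ∈ mmGraph n, eval x t = 0) :
    ∃ g : AffTest n, ∀ A B C : Vec n, eval (pt A B C) t = g.eval A B C := by
  classical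
  obtain ⟨⟨R, κ, LA, LB⟩, hlow⟩ := hasForm_lowPart ht
  obtain ⟨S, Λ, hS, hΛ, h22⟩ := eval_component_22 ht hv hn
  -- the value of `t` everywhere
  have hval : ∀ A B C : Vec n, eval (pt A B C) t
      = R A B + (κ + LA *ᵥ A + LB *ᵥ B) ⬝ᵥ C + ((S *ᵥ C) ⬝ᵥ C + ((Λ - S) *ᵥ prodVec A B) ⬝ᵥ C) := by
    intro A B C
    conv_lhs => rw [← lowPart_add_named t]
    rw [map_add, hlow]
    simp only [map_add, eval_component_33 ht hv, eval_component_32 ht hv, eval_component_23 ht hv,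
      eval_component_31 ht hv, eval_component_13 ht hv, h22, zero_add, add_zero]
    rfl
  -- vanishing on the graph determines `R`
  have hR : ∀ A B : Vec n, R A B = -((κ + LA *ᵥ A + LB *ᵥ B) ⬝ᵥ prodVec A B) := by
    intro A B
    have h := hv _ (pt_prodVec_mem A B)
    rw [hval, sub_mulVec, sub_dotProduct, mulVec_dotProduct_self_eq_zero hΛ] at h
    rw [eq_neg_iff_add_eq_zero, ← h]; ring
  refine ⟨⟨κ, LA, LB, Λ + S⟩, fun A B C => ?_⟩
  rw [hval, hR, AffTest.eval, AffTest.coef]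
  simp only [add_mulVec, sub_mulVec, add_dotProduct, sub_dotProduct, dotProduct_sub]
  have h1 := mulVec_dotProduct_self_eq_zero hΛ C
  have h2 := mulVec_dotProduct_anticomm hΛ C (prodVec A B)
  have h3 := mulVec_dotProduct_comm_of_symm hS C (prodVec A B)
  rw [h1, h2, h3]; ring

end Summit.MatrixMultiplication.MatrixMultiplication.Theorems.GraphEquations

end
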